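import Mathlib
import HarnessLib
import Summits.HubbardSuperconductivity.HubbardSuperconductivity.Theorems.KLProgrammeKLRegimeVolumeLimitHartreeAverage
import Literature.MathematicalPhysics.QuantumLattice.HubbardVertexWick

/-!
# SPACE–TIME TRANSLATION INVARIANCE OF THE LOCAL INSERTION AT FINITE CUTOFF, via a Nambu-odd diagonal phase substitution
# (seat hubbard-kl-k3c5-p2, g2) — Step 2′ of HOME/hubbard-kl-k3c5-p2/TAU-BRIDGE.md §7, complete

Route `KLProgramme`, gen-4 child 5 `KLRegimeVolumeLimitV12` (stmt-HubbardSuperconductivity-19858), `stub_vl_bound` by the direct all-`U` route.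
The `U`-linear term of the bare-frame carrier is `U` times the space–time average of the local insertion `⟨ψ⁺_{(x,t)}ψ⁻_{(x,t)}⟩_{L,M}`
(`…VolumeLimitHartreeAverage`); its `t`-independence at FINITE cutoff is the invariance of the Grassmann measure under the diagonal phase
substitution `θ_u : ψ̂⁺_{kσ} ↦ u_k ψ̂⁺_{kσ}`, `ψ̂⁻_{kσ} ↦ u_k⁻¹ ψ̂⁻_{kσ}` (no definition is introduced — the substitution matrix
`diagonal (c = 0 ? u_k : u_k⁻¹)` is written out):

* `map_diagonal_gen`, `map_phaseDiag_psiPlus/psiMinus` — `θ_u ψ̂^±_{kσ} = u_k^{±1} • ψ̂^±_{kσ}`;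
* `map_phaseDiag_hubbardInteraction` — **`θ_u V = V`** whenever `u_{k₁}u_{k₂}⁻¹u_{k₃}u_{k₄}⁻¹ = 1` on the conserving quadruples;
* `phase_conserving` — the space–time translation phases `u_k = e^{iω_k s₀}χ_{k⃗}(a)` satisfy that (frequency and momentum conservation);
* `map_phaseDiag_positionField_zero/one` — **`θ_u ψ^±_{(y,s)σ} = ψ^±_{(y+a, s+s₀)σ}`** for these phases;
* `phaseDiag_eq_nambu`, `phaseDiag_covariance_invariant` — **`Sᵀ C S = C` for the free covariance at EVERY seed `h`**, for every phase function
  that is ODD under the Nambu flip (`u(−k) = u_k⁻¹`): read through `toNambu` the phase vector is `(c̃ = 0 ? u_{k̃} : u_{k̃}⁻¹)` for both spins, and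
  the Nambu table pairs `c̃ = 1` with `c̃ = 0` at equal `k̃`; `phase_nambu_odd` — the translation phases are Nambu-odd;
* `gaussExpect_localPair_translate` — **`∫dμ_C ψ⁺_{(y+a,s+s₀)σ}ψ⁻_{(y+a,s+s₀)σ}e^{−V} = ∫dμ_C ψ⁺_{(y,s)σ}ψ⁻_{(y,s)σ}e^{−V}`** for every cutoff
  `M`, every `(a, s₀) ∈ 𝕋_L × ℝ`, every real `U` (`gaussExpect_map_toLin'`).

Consequence (with `…HartreeAverage` and `…DensityParseval`): the `U`-linear term of `Σ̂⁰_{L,M}(k,σ̄)` is `U·∫dμ_C ψ⁺_{(0,0)σ}ψ⁻_{(0,0)σ}e^{−V}/Z`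
— t2's time-0 local insertion, whose `M → ∞` limit is identified and bounded (`|·| ≤ 3/2`).  Everything is proved; no definition.
-/

noncomputable section

namespace Summit.HubbardSuperconductivity.HubbardSuperconductivity.Theorems.TwoPointAssembly

set_option linter.dupNamespace false -- summit = problem name (single-conjunct summit), D-0017

open Finset Literature.MathematicalPhysics.QuantumLattice Literature.Probability.LatticeModels GrassmannAlgebra
open scoped ComplexConjugate

variable {L M : ℕ} [NeZero L]

/-- A diagonal substitution rescales each generator: `map (toLin' (diagonal d)) ψ_X = d_X • ψ_X`. -/
theorem map_diagonal_gen (d : HubbardFieldIdx L M → ℂ) (X : HubbardFieldIdx L M) :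
    ExteriorAlgebra.map (Matrix.toLin' (Matrix.diagonal d)) (gen ℂ X) = d X • gen ℂ X := by
  rw [map_gen_eq_sum, LinearMap.toMatrix'_toLin', Finset.sum_eq_single X]
  · rw [Matrix.diagonal_apply_eq]
  · intro X' _ h; rw [Matrix.diagonal_apply_ne _ h, zero_smul]
  · intro h; exact absurd (Finset.mem_univ _) h

/-- The phase substitution on `ψ̂⁺`: `θ_u ψ̂⁺_{kσ} = u_k • ψ̂⁺_{kσ}`. -/
theorem map_phaseDiag_psiPlus (u : FreqMomentum L M → ℂ) (k : FreqMomentum L M) (σ : Fin 2) :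
    ExteriorAlgebra.map (Matrix.toLin' (Matrix.diagonal fun X : HubbardFieldIdx L M => if X.2 = 0 then u X.1.1 else (u X.1.1)⁻¹))
        (psiPlus k σ) = u k • psiPlus k σ := by
  rw [psiPlus, map_diagonal_gen]; simp

/-- The phase substitution on `ψ̂⁻`: `θ_u ψ̂⁻_{kσ} = u_k⁻¹ • ψ̂⁻_{kσ}`. -/
theorem map_phaseDiag_psiMinus (u : FreqMomentum L M → ℂ) (k : FreqMomentum L M) (σ : Fin 2) :
    ExteriorAlgebra.map (Matrix.toLin' (Matrix.diagonal fun X : HubbardFieldIdx L M => if X.2 = 0 then u X.1.1 else (u X.1.1)⁻¹))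
        (psiMinus k σ) = (u k)⁻¹ • psiMinus k σ := by
  rw [psiMinus, map_diagonal_gen]; simp

/-- **THE INTERACTION IS INVARIANT** under every phase substitution whose phases are trivial on the conserving quadruples. -/
theorem map_phaseDiag_hubbardInteraction (β U : ℝ) (u : FreqMomentum L M → ℂ)
    (hcons : ∀ k₁ k₂ k₃ k₄ : FreqMomentum L M,
      (matsubaraInt M k₁.1 + matsubaraInt M k₃.1 = matsubaraInt M k₂.1 + matsubaraInt M k₄.1 ∧ k₁.2 + k₃.2 = k₂.2 + k₄.2) →
        u k₁ * (u k₂)⁻¹ * (u k₃ * (u k₄)⁻¹) = 1) :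
    ExteriorAlgebra.map (Matrix.toLin' (Matrix.diagonal fun X : HubbardFieldIdx L M => if X.2 = 0 then u X.1.1 else (u X.1.1)⁻¹))
        (hubbardInteraction L M β U) = hubbardInteraction L M β U := by
  rw [hubbardInteraction, map_smul]
  congr 1
  simp only [map_sum]
  refine Finset.sum_congr rfl fun k₁ _ => Finset.sum_congr rfl fun k₂ _ => Finset.sum_congr rfl fun k₃ _ =>
    Finset.sum_congr rfl fun k₄ _ => ?_
  split_ifs with h
  · rw [map_mul, map_mul, map_mul, map_phaseDiag_psiPlus, map_phaseDiag_psiMinus, map_phaseDiag_psiPlus, map_phaseDiag_psiMinus,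
      smul_mul_smul_comm, smul_mul_smul_comm, smul_mul_smul_comm,
      show u k₁ * (u k₂)⁻¹ * u k₃ * (u k₄)⁻¹ = 1 by rw [mul_assoc, hcons k₁ k₂ k₃ k₄ h], one_smul]
  · exact map_zero _

/-- **The space–time translation phases are conserving**: for `u_k = e^{iω_k s₀}·χ_{k⃗}(a)`,
`u_{k₁}u_{k₂}⁻¹u_{k₃}u_{k₄}⁻¹ = 1` whenever `n₁ + n₃ = n₂ + n₄` and `k⃗₁ + k⃗₃ = k⃗₂ + k⃗₄`. -/
theorem phase_conserving (β s₀ : ℝ) (a : TorusSite 2 L) (k₁ k₂ k₃ k₄ : FreqMomentum L M)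
    (h : matsubaraInt M k₁.1 + matsubaraInt M k₃.1 = matsubaraInt M k₂.1 + matsubaraInt M k₄.1 ∧ k₁.2 + k₃.2 = k₂.2 + k₄.2) :
    (Complex.exp (((matsubaraFreq β M k₁.1 * s₀ : ℝ) : ℂ) * Complex.I) * torusChar k₁.2 a) *
        (Complex.exp (((matsubaraFreq β M k₂.1 * s₀ : ℝ) : ℂ) * Complex.I) * torusChar k₂.2 a)⁻¹ *
      ((Complex.exp (((matsubaraFreq β M k₃.1 * s₀ : ℝ) : ℂ) * Complex.I) * torusChar k₃.2 a) *
        (Complex.exp (((matsubaraFreq β M k₄.1 * s₀ : ℝ) : ℂ) * Complex.I) * torusChar k₄.2 a)⁻¹) = 1 := by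
  obtain ⟨h1, h2⟩ := h
  have hχ : ∀ q : TorusSite 2 L, torusChar q a ≠ 0 := fun q hq => by
    have := norm_torusChar q a; rw [hq, norm_zero] at this; exact zero_ne_one this
  have hsp : torusChar k₁.2 a * torusChar k₃.2 a = torusChar k₂.2 a * torusChar k₄.2 a := by
    rw [← torusChar_add_left, ← torusChar_add_left, h2]
  have hfr : matsubaraFreq β M k₁.1 * s₀ + matsubaraFreq β M k₃.1 * s₀ = matsubaraFreq β M k₂.1 * s₀ + matsubaraFreq β M k₄.1 * s₀ := by
    have h1' : (matsubaraInt M k₁.1 : ℝ) + matsubaraInt M k₃.1 = matsubaraInt M k₂.1 + matsubaraInt M k₄.1 := by exact_mod_cast h1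
    have e : ∀ m : MatsubaraIdx M, matsubaraFreq β M m * s₀ = (Real.pi * s₀ / β) * (2 * (matsubaraInt M m : ℝ) + 1) := fun m => by
      simp only [matsubaraFreq]; ring
    rw [e, e, e, e, ← mul_add, ← mul_add]
    congr 1
    linear_combination 2 * h1'
  have hexp : Complex.exp (((matsubaraFreq β M k₁.1 * s₀ : ℝ) : ℂ) * Complex.I) * Complex.exp (((matsubaraFreq β M k₃.1 * s₀ : ℝ) : ℂ) * Complex.I) =
      Complex.exp (((matsubaraFreq β M k₂.1 * s₀ : ℝ) : ℂ) * Complex.I) * Complex.exp (((matsubaraFreq β M k₄.1 * s₀ : ℝ) : ℂ) * Complex.I) := by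
    rw [← Complex.exp_add, ← Complex.exp_add, ← add_mul, ← add_mul, ← Complex.ofReal_add, ← Complex.ofReal_add, hfr]
  have hne2 : Complex.exp (((matsubaraFreq β M k₂.1 * s₀ : ℝ) : ℂ) * Complex.I) * torusChar k₂.2 a ≠ 0 :=
    mul_ne_zero (Complex.exp_ne_zero _) (hχ _)
  have hne4 : Complex.exp (((matsubaraFreq β M k₄.1 * s₀ : ℝ) : ℂ) * Complex.I) * torusChar k₄.2 a ≠ 0 :=
    mul_ne_zero (Complex.exp_ne_zero _) (hχ _)
  have key : Complex.exp (((matsubaraFreq β M k₁.1 * s₀ : ℝ) : ℂ) * Complex.I) * torusChar k₁.2 a *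
      (Complex.exp (((matsubaraFreq β M k₃.1 * s₀ : ℝ) : ℂ) * Complex.I) * torusChar k₃.2 a) =
      Complex.exp (((matsubaraFreq β M k₂.1 * s₀ : ℝ) : ℂ) * Complex.I) * torusChar k₂.2 a *
        (Complex.exp (((matsubaraFreq β M k₄.1 * s₀ : ℝ) : ℂ) * Complex.I) * torusChar k₄.2 a) := by
    linear_combination (torusChar k₁.2 a * torusChar k₃.2 a) * hexp +
      (Complex.exp (((matsubaraFreq β M k₂.1 * s₀ : ℝ) : ℂ) * Complex.I) * Complex.exp (((matsubaraFreq β M k₄.1 * s₀ : ℝ) : ℂ) * Complex.I)) * hsp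
  have hne : Complex.exp (((matsubaraFreq β M k₂.1 * s₀ : ℝ) : ℂ) * Complex.I) * torusChar k₂.2 a *
      (Complex.exp (((matsubaraFreq β M k₄.1 * s₀ : ℝ) : ℂ) * Complex.I) * torusChar k₄.2 a) ≠ 0 := mul_ne_zero hne2 hne4
  calc _ = Complex.exp (((matsubaraFreq β M k₁.1 * s₀ : ℝ) : ℂ) * Complex.I) * torusChar k₁.2 a *
        (Complex.exp (((matsubaraFreq β M k₃.1 * s₀ : ℝ) : ℂ) * Complex.I) * torusChar k₃.2 a) *
        (Complex.exp (((matsubaraFreq β M k₂.1 * s₀ : ℝ) : ℂ) * Complex.I) * torusChar k₂.2 a *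
          (Complex.exp (((matsubaraFreq β M k₄.1 * s₀ : ℝ) : ℂ) * Complex.I) * torusChar k₄.2 a))⁻¹ := by
          rw [mul_inv]; ring
    _ = 1 := by rw [key, mul_inv_cancel₀ hne]

/-- **The translation phases SHIFT the `ψ⁺` position–time field**: `θ_u ψ⁺_{(y,s)σ} = ψ⁺_{(y+a, s+s₀)σ}` for `u_k = e^{iω_k s₀}χ_{k⃗}(a)`. -/
theorem map_phaseDiag_positionField_zero (β s₀ : ℝ) (a : TorusSite 2 L) (σ : Fin 2) (y : TorusSite 2 L) (s : ℝ) :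
    ExteriorAlgebra.map (Matrix.toLin' (Matrix.diagonal fun X : HubbardFieldIdx L M =>
        if X.2 = 0 then Complex.exp (((matsubaraFreq β M X.1.1.1 * s₀ : ℝ) : ℂ) * Complex.I) * torusChar X.1.1.2 a
        else (Complex.exp (((matsubaraFreq β M X.1.1.1 * s₀ : ℝ) : ℂ) * Complex.I) * torusChar X.1.1.2 a)⁻¹))
        (positionField L M β 0 σ y s) = positionField L M β 0 σ (y + a) (s + s₀) := by
  rw [positionField, positionField, map_sum]
  refine Finset.sum_congr rfl fun k _ => ?_
  rw [map_smul, map_diagonal_gen, smul_smul]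
  congr 1
  simp only [if_true]
  rw [mul_assoc, conj_vertexPlaneWave_zero_eq, conj_vertexPlaneWave_zero_eq, torusChar_add_right]
  rw [show Complex.exp (((matsubaraFreq β M k.1 * (s + s₀) : ℝ) : ℂ) * Complex.I) =
      Complex.exp (((matsubaraFreq β M k.1 * s : ℝ) : ℂ) * Complex.I) * Complex.exp (((matsubaraFreq β M k.1 * s₀ : ℝ) : ℂ) * Complex.I) by
    rw [← Complex.exp_add]; push_cast; ring_nf]
  ring

/-- **The translation phases SHIFT the `ψ⁻` position–time field**: `θ_u ψ⁻_{(y,s)σ} = ψ⁻_{(y+a, s+s₀)σ}`. -/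
theorem map_phaseDiag_positionField_one (β s₀ : ℝ) (a : TorusSite 2 L) (σ : Fin 2) (y : TorusSite 2 L) (s : ℝ) :
    ExteriorAlgebra.map (Matrix.toLin' (Matrix.diagonal fun X : HubbardFieldIdx L M =>
        if X.2 = 0 then Complex.exp (((matsubaraFreq β M X.1.1.1 * s₀ : ℝ) : ℂ) * Complex.I) * torusChar X.1.1.2 a
        else (Complex.exp (((matsubaraFreq β M X.1.1.1 * s₀ : ℝ) : ℂ) * Complex.I) * torusChar X.1.1.2 a)⁻¹))
        (positionField L M β 1 σ y s) = positionField L M β 1 σ (y + a) (s + s₀) := by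
  rw [positionField, positionField, map_sum]
  refine Finset.sum_congr rfl fun k _ => ?_
  rw [map_smul, map_diagonal_gen, smul_smul]
  congr 1
  simp only [show (1 : Fin 2) ≠ 0 from by decide, if_false]
  have hinvχ : (torusChar k.2 a)⁻¹ = conj (torusChar k.2 a) := inv_eq_of_mul_eq_one_right (torusChar_mul_conj k.2 a)
  have hinve : (Complex.exp (((matsubaraFreq β M k.1 * s₀ : ℝ) : ℂ) * Complex.I))⁻¹ =
      Complex.exp (-(((matsubaraFreq β M k.1 * s₀ : ℝ) : ℂ) * Complex.I)) := by rw [Complex.exp_neg]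
  rw [mul_assoc, mul_inv, hinvχ, hinve, conj_vertexPlaneWave_one_eq, conj_vertexPlaneWave_one_eq, torusChar_add_right, map_mul]
  rw [show Complex.exp (-(((matsubaraFreq β M k.1 * (s + s₀) : ℝ) : ℂ) * Complex.I)) =
      Complex.exp (-(((matsubaraFreq β M k.1 * s : ℝ) : ℂ) * Complex.I)) * Complex.exp (-(((matsubaraFreq β M k.1 * s₀ : ℝ) : ℂ) * Complex.I)) by
    rw [← Complex.exp_add]; push_cast; ring_nf]
  ring

omit [NeZero L] in
/-- The phase vector read through the Nambu relabelling: for a phase function odd under the Nambu flip (`u(−k) = u_k⁻¹`),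
`d_X = (c̃ = 0 ? u_{k̃} : u_{k̃}⁻¹)` with `(k̃, ·, c̃) = toNambu X` — for BOTH spins. -/
theorem phaseDiag_eq_nambu (u : FreqMomentum L M → ℂ) (hodd : ∀ k, u k.neg = (u k)⁻¹) (X : HubbardFieldIdx L M) :
    (if X.2 = 0 then u X.1.1 else (u X.1.1)⁻¹) =
      (if (toNambu X).2 = 0 then u (toNambu X).1.1 else (u (toNambu X).1.1)⁻¹) := by
  obtain ⟨⟨k, σ⟩, c⟩ := X
  unfold toNambu
  by_cases hσ : σ = 0
  · simp [hσ]
  · simp only [hσ, if_false]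
    fin_cases c
    · simp [hodd]
    · simp [hodd, show Fin.rev (1 : Fin 2) = 0 from by decide]

/-- **THE FREE COVARIANCE IS INVARIANT** under every Nambu-odd phase substitution (every seed `h`): `Sᵀ C S = C`, `S = diagonal d`. -/
theorem phaseDiag_covariance_invariant (u : FreqMomentum L M → ℂ) (hu : ∀ k, u k ≠ 0) (hodd : ∀ k, u k.neg = (u k)⁻¹) (β μ h : ℝ) :
    (Matrix.diagonal fun X : HubbardFieldIdx L M => if X.2 = 0 then u X.1.1 else (u X.1.1)⁻¹).transpose *
        hubbardCovariance L M β μ h * (Matrix.diagonal fun X : HubbardFieldIdx L M => if X.2 = 0 then u X.1.1 else (u X.1.1)⁻¹) =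
      hubbardCovariance L M β μ h := by
  ext X Y
  rw [Matrix.diagonal_transpose, Matrix.mul_diagonal, Matrix.diagonal_mul, hubbardCovariance, Matrix.of_apply,
    phaseDiag_eq_nambu u hodd X, phaseDiag_eq_nambu u hodd Y, hubbardTwoPoint]
  -- both Nambu terms are supported on `c̃_X ≠ c̃_Y`, `k̃_X = k̃_Y`, where the two phases cancel
  have key : ∀ A B : (FreqMomentum L M × Fin 2) × Fin 2,
      (if A.2 = 0 then u A.1.1 else (u A.1.1)⁻¹) * nambuTwoPoint L M β μ h A B * (if B.2 = 0 then u B.1.1 else (u B.1.1)⁻¹) =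
        nambuTwoPoint L M β μ h A B := by
    intro A B
    unfold nambuTwoPoint
    by_cases hcnd : A.2 = 1 ∧ B.2 = 0 ∧ A.1.1 = B.1.1
    · obtain ⟨hA, hB, hk⟩ := hcnd
      have hA0 : ¬ A.2 = 0 := by rw [hA]; decide
      rw [if_neg hA0, if_pos hB, if_pos (show A.2 = 1 ∧ B.2 = 0 ∧ A.1.1 = B.1.1 from ⟨hA, hB, hk⟩), hk]
      have huB := hu B.1.1
      field_simp
    · rw [if_neg hcnd]; simp
  have k1 := key (toNambu X) (toNambu Y)
  have k2 := key (toNambu Y) (toNambu X)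
  linear_combination -k1 + k2

/-- The translation phases are Nambu-odd: `u(−k) = u_k⁻¹` for `u_k = e^{iω_k s₀}χ_{k⃗}(a)` (`ω_{rev n} = −ω_n`, `χ_{−k⃗}(a) = conj χ_{k⃗}(a)`). -/
theorem phase_nambu_odd (β s₀ : ℝ) (a : TorusSite 2 L) (k : FreqMomentum L M) :
    Complex.exp (((matsubaraFreq β M k.neg.1 * s₀ : ℝ) : ℂ) * Complex.I) * torusChar k.neg.2 a =
      (Complex.exp (((matsubaraFreq β M k.1 * s₀ : ℝ) : ℂ) * Complex.I) * torusChar k.2 a)⁻¹ := by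
  have hinvχ : (torusChar k.2 a)⁻¹ = conj (torusChar k.2 a) := inv_eq_of_mul_eq_one_right (torusChar_mul_conj k.2 a)
  rw [mul_inv, hinvχ, ← Complex.exp_neg]
  simp only [FreqMomentum.neg, matsubaraFreq_rev]
  rw [torusChar_comm, torusChar_neg_right, torusChar_comm]
  push_cast
  ring_nf

/-- **SPACE–TIME TRANSLATION INVARIANCE OF THE LOCAL INSERTION AT FINITE CUTOFF**: for every `β, U, μ`, every cutoff `M`, every shift
`(a, s₀) ∈ 𝕋_L × ℝ`: `∫dμ_C ψ⁺_{(y+a,s+s₀)σ}ψ⁻_{(y+a,s+s₀)σ}e^{−V} = ∫dμ_C ψ⁺_{(y,s)σ}ψ⁻_{(y,s)σ}e^{−V}` (bare covariance, seed `0`). -/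
theorem gaussExpect_localPair_translate (β U μ s₀ : ℝ) (a y : TorusSite 2 L) (s : ℝ) (σ : Fin 2) :
    gaussExpect ℂ (hubbardCovariance L M β μ 0)
        (positionField L M β 0 σ (y + a) (s + s₀) * positionField L M β 1 σ (y + a) (s + s₀) *
          grassmannExp (-(hubbardInteraction L M β U))) =
      gaussExpect ℂ (hubbardCovariance L M β μ 0)
        (positionField L M β 0 σ y s * positionField L M β 1 σ y s * grassmannExp (-(hubbardInteraction L M β U))) := by
  have hu : ∀ k : FreqMomentum L M, Complex.exp (((matsubaraFreq β M k.1 * s₀ : ℝ) : ℂ) * Complex.I) * torusChar k.2 a ≠ 0 := by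
    intro k
    refine mul_ne_zero (Complex.exp_ne_zero _) fun hq => ?_
    have := norm_torusChar k.2 a; rw [hq, norm_zero] at this; exact zero_ne_one this
  have hC := phaseDiag_covariance_invariant (L := L) (M := M)
    (fun k : FreqMomentum L M => Complex.exp (((matsubaraFreq β M k.1 * s₀ : ℝ) : ℂ) * Complex.I) * torusChar k.2 a) hu
    (fun k => phase_nambu_odd β s₀ a k) β μ 0
  have hV := map_phaseDiag_hubbardInteraction (L := L) (M := M) β U
    (fun k : FreqMomentum L M => Complex.exp (((matsubaraFreq β M k.1 * s₀ : ℝ) : ℂ) * Complex.I) * torusChar k.2 a)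
    (fun k₁ k₂ k₃ k₄ h => phase_conserving β s₀ a k₁ k₂ k₃ k₄ h)
  have h0 := map_phaseDiag_positionField_zero (L := L) (M := M) β s₀ a σ y s
  have h1 := map_phaseDiag_positionField_one (L := L) (M := M) β s₀ a σ y s
  have hθ : ExteriorAlgebra.map (Matrix.toLin' (Matrix.diagonal fun X : HubbardFieldIdx L M =>
        if X.2 = 0 then Complex.exp (((matsubaraFreq β M X.1.1.1 * s₀ : ℝ) : ℂ) * Complex.I) * torusChar X.1.1.2 a
        else (Complex.exp (((matsubaraFreq β M X.1.1.1 * s₀ : ℝ) : ℂ) * Complex.I) * torusChar X.1.1.2 a)⁻¹))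
        (positionField L M β 0 σ y s * positionField L M β 1 σ y s * grassmannExp (-(hubbardInteraction L M β U))) =
      positionField L M β 0 σ (y + a) (s + s₀) * positionField L M β 1 σ (y + a) (s + s₀) *
        grassmannExp (-(hubbardInteraction L M β U)) := by
    rw [map_mul, map_mul, h0, h1, map_grassmannExp_eq, map_neg, hV]
  rw [← hθ, gaussExpect_map_toLin', hC]

end Summit.HubbardSuperconductivity.HubbardSuperconductivity.Theorems.TwoPointAssembly

end
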